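import Summits.BirchSwinnertonDyer.BirchSwinnertonDyer.Theorems.ErratumRoadFiveRest3DLeverRungD5
import Summits.BirchSwinnertonDyer.BirchSwinnertonDyer.Theses.ErratumRoadFive
import HarnessLib

/-!
# Route `ErratumRoadFive` (rung K2, `p ≥ 5`), crux `RamNoErratumDataAtFive` (item stmt-BirchSwinnertonDyer-19624, REST‴):
# the registered lever rung R10 `stub_rung_shaDiv_D5_lever` (skeleton v8) BY NAME, and the Schneider-on-(D) input at (D5, 5) from
# `PublishedInputsFive` alone (cell `bsd-stepL`, OWNER seat `bsd-stepL-rest-p2` g7; `--supports stmt-BirchSwinnertonDyer-19624`; leaf)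

HONEST FRAMING: THEOREMS ONLY; CONDITIONAL on the route's published support items; ONE curve; nothing booked; Schneider's conjecture
class-wide asserted NOWHERE. Twin of `Theorems/ErratumRoadFiveRest3DLeverRungsByName.lean` §2–§3 for the fifth (D)-member D5 = 635b1 ⊗ (−3208),
whose regulator certificate is the SECOND-order one (`Theorems/ErratumRoadFiveRest3DLeverCertKernelD5.lean`).
References: [Skinner2016PacificMC] Thm. A; [SteinWuthrich2013] Thm. 6.1, §4.2, Conj. 4.1; [Disegni2020] Thm. 1; [JetchevSkinnerWan2017]
Thm. 3.3.1; [KolyvaginEulerSystems1990] Thm. A.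
-/

-- the Theorems namespace of this sub repeats the summit name by design (D-0017 nested layout)
set_option linter.dupNamespace false

noncomputable section

open scoped Classical

open WeierstrassCurve
  Literature.NumberTheory.EllipticCurves Literature.NumberTheory.EllipticCurves.ModularForms
  Literature.NumberTheory.EllipticCurves.Rank1Residual
  Literature.NumberTheory.EllipticCurves.Rank1Residual.Typed
  Literature.NumberTheory.EllipticCurves.JetchevSkinnerWan2017
  Literature.NumberTheory.EllipticCurves.SteinWuthrich2013
  Literature.NumberTheory.EllipticCurves.Disegni2020
  Literature.NumberTheory.EllipticCurves.Skinner2016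
  Summit.BirchSwinnertonDyer.Rank1Residual Summit.BirchSwinnertonDyer.Rank1Residual.X11b
  Summit.BirchSwinnertonDyer.BirchSwinnertonDyer.Theses.ErratumRoadFive

namespace Summit.BirchSwinnertonDyer.BirchSwinnertonDyer.Theorems

namespace Rest3Rungs

/-- **REGISTERED RUNG `stub_rung_shaDiv_D5_lever` (skeleton v8, R10) BY NAME — LEVER-ROAD RUNG at `(D5, 5)`**: `PublishedInputsFive` (19066) +
`JSWAnticyclotomicControlMult` (19626) + the lever-fact bundle ⟹ `P2OpenInputOnTreeAt D5 5` — NO certificate or data binder (the regulator input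
is the second-order kernel theorem `RegMult.LeverD.regulatorNonvanishingAt_D5_baseChange_of_GZK`). CONDITIONAL on the published items; ONE curve;
nothing booked. [cite: Skinner2016PacificMC, Thm. A (§1)] [cite: SteinWuthrich2013, Thm. 6.1, §4.2] [cite: Disegni2020, Thm. 1 (§1.2)]
[cite: JetchevSkinnerWan2017, Thm. 3.3.1] -/
theorem stub_rung_shaDiv_D5_lever
    [((⟨0, 1, 0, -6646441, -6627061835⟩ : WeierstrassCurve ℤ).baseChange ℚ).IsElliptic]
    [((⟨0, 1, 0, -6646441, -6627061835⟩ : WeierstrassCurve ℤ).baseChange ℚ).IsGloballyMinimal]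
    (hF : Summit.BirchSwinnertonDyer.BirchSwinnertonDyer.Theses.ErratumRoadFive.PublishedInputsFive)
    (h331 : Summit.BirchSwinnertonDyer.BirchSwinnertonDyer.Theses.ErratumRoadFive.JSWAnticyclotomicControlMult)
    (hL : Literature.NumberTheory.EllipticCurves.Skinner2016.thmA_charIdeal_multiplicative ∧
      Literature.NumberTheory.EllipticCurves.SteinWuthrich2013.thm61_nonsplitMultiplicative ∧
      Literature.NumberTheory.EllipticCurves.SteinWuthrich2013.thm61_splitMultiplicative ∧
      Literature.NumberTheory.EllipticCurves.SteinWuthrich2013.exists_isMultCanonical ∧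
      Literature.NumberTheory.EllipticCurves.SteinWuthrich2013.exists_isSplitMultCanonical ∧
      Literature.NumberTheory.EllipticCurves.Disegni2020.thm1_padicBSD_rankOne_multiplicative ∧
      Literature.NumberTheory.EllipticCurves.ModularForms.nonempty_modularParametrizationData) :
    Summit.BirchSwinnertonDyer.Rank1Residual.X11b.P2OpenInputOnTreeAt
      ((⟨0, 1, 0, -6646441, -6627061835⟩ : WeierstrassCurve ℤ).baseChange ℚ) 5 := by
  obtain ⟨hGZ, hKo, -, hSk, -, hGZK, hmod, -, -, -, -, -, -, -, -⟩ := hF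
  obtain ⟨hSkA, hJn, hJs, hHn, hHs, hD, hpar⟩ := hL
  exact rung_D5_lever hGZ hKo hSk hGZK hmod h331 hSkA hJn hJs hHn hHs hD hpar

/-- **Schneider AT THE PAIR `(D5, 5)` from the support item `PublishedInputsFive` alone** (its GZK conjunct; the computation is the second-order
kernel certificate): given `ClassX11b D5 5`, `ClassClosure.RegulatorNonvanishingAt D5 5`. ONE curve; nothing class-wide.
[cite: SteinWuthrich2013, §4.2 and Conj. 4.1] [cite: KolyvaginEulerSystems1990, Thm. A] -/
theorem regulatorOnD_D5_of_items
    [((⟨0, 1, 0, -6646441, -6627061835⟩ : WeierstrassCurve ℤ).baseChange ℚ).IsElliptic] [((⟨0, 1, 0, -6646441, -6627061835⟩ : WeierstrassCurve ℤ).baseChange ℚ).IsGloballyMinimal]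
    (hF : PublishedInputsFive) (hX : ClassX11b ((⟨0, 1, 0, -6646441, -6627061835⟩ : WeierstrassCurve ℤ).baseChange ℚ) 5) :
    ClassClosure.RegulatorNonvanishingAt ((⟨0, 1, 0, -6646441, -6627061835⟩ : WeierstrassCurve ℤ).baseChange ℚ) 5 := by
  obtain ⟨-, -, -, -, -, hGZK, -, -, -, -, -, -, -, -, -⟩ := hF
  exact RegMult.LeverD.regulatorNonvanishingAt_D5_baseChange_of_GZK hGZK hX

end Rest3Rungs

end Summit.BirchSwinnertonDyer.BirchSwinnertonDyer.Theorems

end
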